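import Literature.NumberTheory.EllipticCurves.RootNumberTwistProofs
import HarnessLib

/-!
# `w(E) = −∏_p W_p(E)`: the residual input after the Modularity Theorem, stated exactly

A `…Proofs` sibling (theorems only: no definition, no named fact, no instance) of the named fact
`WeierstrassCurve.rootNumber_eq_algebraicRootNumber` (`RootNumber.lean`; Deligne 1973, Rohrlich 1994
§§19–20, Kellock–Dokchitser 2023 Def. 2.1: for an elliptic `W / ℚ` with no additive reduction above
`2, 3`, the analytic root number is `−∏ᶠ_v w_v(E)` with Rohrlich's local root numbers).

State of the tree (all theorems): Hecke's functional equation, Atkin–Lehner's `ε(f) = ∏_p λ_p(f)` and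
`λ_p(f) = ±1` (Knapp 1993, Thm. 9.27), Kellock–Dokchitser's Remark 2.2 `λ_p(f) = w_p(E)` at the
multiplicative primes (`atkinLehnerEigenvalueAt_eq_localRootNumberAt_of_not_sq_dvd`) and at the additive
primes `p ≥ 5` of quadratic-twist type, i.e. such that `E^{(p*)}`, `p* = (−1)^{(p−1)/2} p`, is not
additive at `p` (`atkinLehnerEigenvalueAt_eq_localRootNumberAt_of_twist`, file `RootNumberTwistProofs`).
This file records, as theorems with explicit hypotheses, exactly what is left: from the Modularity
Theorem `exists_isNewformOf` (Breuil–Conrad–Diamond–Taylor 2001, Thm. A) and the single residual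
local statement

  (R) `λ_p(f) = w_p(E)` for the newform `f` of `E` at every additive prime `p ≥ 5` at which the
      quadratic twist `E^{(p*)}` is still additive

(the hypothesis `hres` below; by Rohrlich 1993, Prop. 2, these are the primes `p ≥ 5` of potentially
good reduction with `e = 12 / gcd(v_p(Δ_min), 12) ∈ {3, 4, 6}`, where `w_p(E) = (−3/p), (−2/p), (−1/p)`
respectively and where Remark 2.2 rests on the local Langlands correspondence for the non-twist-minimal
principal series and the supercuspidal representations of conductor `p²` — not formalised here), one
gets Kellock–Dokchitser's Remark 2.2 at every `p ∣ N_E`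
(`atkinLehnerEigenvalueAt_eq_localRootNumberAt_of_residual`), the local product formula
`ε(f) = ∏ᶠ_v w_v(E)` (`frickeEigenvalue_eq_finprod_localRootNumberAt_of_residual`), the functional
equation with the algebraic sign (`hasFunctionalEquationSign_algebraicRootNumber_of_residual`) and the
named fact itself (`rootNumber_eq_algebraicRootNumber_of_exists_isNewformOf_of_residual`). With
`hres` vacuous this recovers `rootNumber_eq_algebraicRootNumber_of_exists_isNewformOf_of_twist`.
No new definitions, no named facts.

## References

* L. Cowland Kellock, V. Dokchitser, *Root numbers and parity phenomena*, Bull. LMS 55 (2023),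
  Def. 2.1, Rem. 2.2, Thm. 2.3.
* D. Rohrlich, *Variation of the root number in families of elliptic curves*, Compositio Math. 87
  (1993), Prop. 2.
* C. Breuil, B. Conrad, F. Diamond, R. Taylor, JAMS 14 (2001), Thm. A.
* A. W. Knapp, *Elliptic Curves*, 1993, Thm. 9.27.
-/

noncomputable section

open scoped MatrixGroups Classical

open CongruenceSubgroup Literature.NumberTheory.EllipticCurves.ModularForms IsDedekindDomain
  IsDedekindDomain.HeightOneSpectrum Rat.HeightOneSpectrum

namespace WeierstrassCurve

variable (W : WeierstrassCurve ℚ)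

/-- **Kellock–Dokchitser's Remark 2.2 at every `p ∣ N_E`, from the Modularity Theorem and the residual
statement (R).** For an elliptic `W / ℚ` with no additive reduction above `2, 3`: if `λ_p(f) = w_p(E)`
holds at the additive primes `p ≥ 5` at which `E^{(p*)}` is still additive (`hres`), then it holds at
every prime `p ∣ N_E` (the named fact `W.atkinLehnerEigenvalueAt_eq_localRootNumberAt`): at `p ∥ N_E` by
`atkinLehnerEigenvalueAt_eq_localRootNumberAt_of_not_sq_dvd` (Knapp 1993, Thm. 9.27; `a_p = ±1`), at the
additive primes of quadratic-twist type by `atkinLehnerEigenvalueAt_eq_localRootNumberAt_of_twist`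
(which uses Modularity for `E^{(p*)}`). [cite: KellockDokchitser2023, Rem. 2.2 and Thm. 2.3]
[cite: Rohrlich1993Compositio, Prop. 2] -/
theorem atkinLehnerEigenvalueAt_eq_localRootNumberAt_of_residual (hmod : exists_isNewformOf)
    [W.IsElliptic]
    (h23 : ∀ v : HeightOneSpectrum ℤ, W.HasAdditiveReductionAt v → 3 < ringChar (ℤ ⧸ v.asIdeal))
    (hres : ∀ [W.IsElliptic] [NeZero (W.conductorNorm ℤ)] {f : CuspForm (Gamma0 (W.conductorNorm ℤ)) 2}
      (_hf : IsNewformOf W f) (p : Nat.Primes), 5 ≤ (p : ℕ) →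
      W.HasAdditiveReductionAt ((primesEquiv (R := ℤ)).symm p) →
      (W.quadraticTwist (((-1 : ℤ) ^ ((p : ℕ) / 2) * p : ℤ) : ℚ)).HasAdditiveReductionAt
        ((primesEquiv (R := ℤ)).symm p) →
      atkinLehnerEigenvalueAt f p = (W.localRootNumberAt ((primesEquiv (R := ℤ)).symm p) : ℂ)) :
    W.atkinLehnerEigenvalueAt_eq_localRootNumberAt := by
  intro _ _ f hf p hp _
  by_cases hsq : (p : ℕ) ^ 2 ∣ W.conductorNorm ℤ
  · have hN0 : W.conductorNorm ℤ ≠ 0 := (W.conductorNorm_pos_holds).ne'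
    have hgen : natGenerator ((primesEquiv (R := ℤ)).symm p) = p :=
      congrArg (fun q : Nat.Primes ↦ (q : ℕ)) ((primesEquiv (R := ℤ)).apply_symm_apply p)
    have h2 : 2 ≤ W.conductorExponent ((primesEquiv (R := ℤ)).symm p) := by
      rw [← factorization_conductorNorm_holds W ((primesEquiv (R := ℤ)).symm p), hgen]
      exact (p.2.pow_dvd_iff_le_factorization hN0).mp hsq
    have hadd := (two_le_conductorExponent_iff_holds _ W).mp h2
    have h3 := h23 _ hadd
    rw [Literature.NumberTheory.EllipticCurves.Rat.ringChar_int_quotient_asIdeal, hgen] at h3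
    have hp4 : (p : ℕ) ≠ 4 := fun h ↦ absurd p.2 (by rw [h]; norm_num)
    have hp5 : 5 ≤ (p : ℕ) := by omega
    by_cases htw : (W.quadraticTwist (((-1 : ℤ) ^ ((p : ℕ) / 2) * p : ℤ) : ℚ)).HasAdditiveReductionAt
        ((primesEquiv (R := ℤ)).symm p)
    · exact hres hf p hp5 hadd htw
    · exact W.atkinLehnerEigenvalueAt_eq_localRootNumberAt_of_twist hmod hf p hp5 hadd htw h23
  · exact W.atkinLehnerEigenvalueAt_eq_localRootNumberAt_of_not_sq_dvd hf p hp hsq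

/-- **The local product formula `ε(f_E) = ∏ᶠ_v w_v(E)` from the Modularity Theorem and the residual
statement (R)**: the named fact `W.frickeEigenvalue_eq_finprod_localRootNumberAt` (Kellock–Dokchitser
2023, Rem. 2.2 with Atkin–Lehner's `ε(f) = ∏_p λ_p(f)`, Knapp 1993, Thm. 9.27(c), a theorem of the tree)
for an elliptic `W / ℚ`, from `exists_isNewformOf` and `hres`.
[cite: KellockDokchitser2023, Rem. 2.2] [cite: Knapp1993, Thm. 9.27(c)] -/
theorem frickeEigenvalue_eq_finprod_localRootNumberAt_of_residual (hmod : exists_isNewformOf)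
    (hres : ∀ [W.IsElliptic] [NeZero (W.conductorNorm ℤ)] {f : CuspForm (Gamma0 (W.conductorNorm ℤ)) 2}
      (_hf : IsNewformOf W f) (p : Nat.Primes), 5 ≤ (p : ℕ) →
      W.HasAdditiveReductionAt ((primesEquiv (R := ℤ)).symm p) →
      (W.quadraticTwist (((-1 : ℤ) ^ ((p : ℕ) / 2) * p : ℤ) : ℚ)).HasAdditiveReductionAt
        ((primesEquiv (R := ℤ)).symm p) →
      atkinLehnerEigenvalueAt f p = (W.localRootNumberAt ((primesEquiv (R := ℤ)).symm p) : ℂ)) :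
    W.frickeEigenvalue_eq_finprod_localRootNumberAt := by
  intro _ _ h23 f hf
  exact W.frickeEigenvalue_eq_finprod_localRootNumberAt_of_localRootNumberAt
    (W.atkinLehnerEigenvalueAt_eq_localRootNumberAt_of_residual hmod h23 hres) h23 hf

/-- **`Λ(E, 2 − s) = −∏_p w_p(E) · Λ(E, s)` from the Modularity Theorem and the residual statement
(R)**, for an elliptic `W / ℚ` with no additive reduction above `2, 3` (Kellock–Dokchitser 2023,
Def. 2.1 and Rem. 2.2; Knapp 1993, Thm. 9.8 and Thm. 9.27).
[cite: KellockDokchitser2023, Def. 2.1 and Rem. 2.2] [cite: Knapp1993, Thm. 9.8 and Thm. 9.27] -/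
theorem hasFunctionalEquationSign_algebraicRootNumber_of_residual (hmod : exists_isNewformOf)
    [W.IsElliptic]
    (h23 : ∀ v : HeightOneSpectrum ℤ, W.HasAdditiveReductionAt v → 3 < ringChar (ℤ ⧸ v.asIdeal))
    (hres : ∀ [W.IsElliptic] [NeZero (W.conductorNorm ℤ)] {f : CuspForm (Gamma0 (W.conductorNorm ℤ)) 2}
      (_hf : IsNewformOf W f) (p : Nat.Primes), 5 ≤ (p : ℕ) →
      W.HasAdditiveReductionAt ((primesEquiv (R := ℤ)).symm p) →
      (W.quadraticTwist (((-1 : ℤ) ^ ((p : ℕ) / 2) * p : ℤ) : ℚ)).HasAdditiveReductionAt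
        ((primesEquiv (R := ℤ)).symm p) →
      atkinLehnerEigenvalueAt f p = (W.localRootNumberAt ((primesEquiv (R := ℤ)).symm p) : ℂ)) :
    W.HasFunctionalEquationSign W.algebraicRootNumber :=
  W.hasFunctionalEquationSign_algebraicRootNumber_of_localRootNumberAt hmod
    (W.atkinLehnerEigenvalueAt_eq_localRootNumberAt_of_residual hmod h23 hres) h23

/-- **`w(E) = −∏_p w_p(E)` from the Modularity Theorem and the residual statement (R).** The named
fact `W.rootNumber_eq_algebraicRootNumber` (Deligne 1973; Rohrlich 1994, §20; Kellock–Dokchitser 2023,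
Def. 2.1) for an elliptic `W / ℚ` follows from `exists_isNewformOf` (BCDT 2001, Thm. A) together with
`λ_p(f) = w_p(E)` at the additive primes `p ≥ 5` at which `E^{(p*)}` is still additive (`hres`; by
Rohrlich 1993, Prop. 2, the primes of potentially good reduction with `e ∈ {3, 4, 6}`). Everything
else — Hecke, Atkin–Lehner, Remark 2.2 at the multiplicative primes and at the additive primes of
quadratic-twist type — is a theorem of the tree. When `W` has no such prime, `hres` is vacuous and this
is `rootNumber_eq_algebraicRootNumber_of_exists_isNewformOf_of_twist`.
[cite: KellockDokchitser2023, Def. 2.1 and Rem. 2.2] [cite: BCDTJAMS2001, Theorem A]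
[cite: Rohrlich1993Compositio, Prop. 2] -/
theorem rootNumber_eq_algebraicRootNumber_of_exists_isNewformOf_of_residual (hmod : exists_isNewformOf)
    (hres : ∀ [W.IsElliptic] [NeZero (W.conductorNorm ℤ)] {f : CuspForm (Gamma0 (W.conductorNorm ℤ)) 2}
      (_hf : IsNewformOf W f) (p : Nat.Primes), 5 ≤ (p : ℕ) →
      W.HasAdditiveReductionAt ((primesEquiv (R := ℤ)).symm p) →
      (W.quadraticTwist (((-1 : ℤ) ^ ((p : ℕ) / 2) * p : ℤ) : ℚ)).HasAdditiveReductionAt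
        ((primesEquiv (R := ℤ)).symm p) →
      atkinLehnerEigenvalueAt f p = (W.localRootNumberAt ((primesEquiv (R := ℤ)).symm p) : ℂ)) :
    W.rootNumber_eq_algebraicRootNumber := by
  intro _ h23
  exact W.rootNumber_eq_algebraicRootNumber_of_exists_isNewformOf_of_localRootNumberAt hmod
    (W.atkinLehnerEigenvalueAt_eq_localRootNumberAt_of_residual hmod h23 hres) h23

end WeierstrassCurve

end
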